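/-
Origin: expansion seat `planner-pub-hodgecm-pv14-g5-0`, handover #11 2026-08-18T11:01:22Z (`HOME/pub-hodgecm-pv14-g5/lean/Pv14g5/WeilThetaModelHeisenbergAdjoin.lean`, md5 86bf6a95, 658 lines);
landed by the gen-7 packager in gate run 28 as `HodgeCM/Automorphic/WeilThetaModelHeisenbergAdjoin.lean` (import ^import Pv14g5\.→import HodgeCM.Automorphic. ×1).
-/
/-
Origin: HOME/pub-hodgecm-pv14-g5/lean/Pv14g5/WeilThetaModelHeisenbergAdjoin.lean — session planner-pub-hodgecm-pv14-g5-0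
(unit pub-hodgecm-pv14-g5, DAG-node prover #14 gen 5).  Intended final place:
`HodgeCM/Automorphic/WeilThetaModelHeisenbergAdjoin.lean` (namespace `HodgeCM.SchwartzWeil`).
PACKAGER: rewrite `import Pv14g5.WeilThetaModelHeisenbergWeylLattice` to
`import HodgeCM.Automorphic.WeilThetaModelHeisenbergWeylLattice` (this seat's HANDOVER #9).
Asserts nothing (no `axiom`, no new constants).
-/
import Summits.HodgeConjecture.HodgeCM.Automorphic.WeilThetaModelHeisenbergWeylLattice

/-!
# Adjoining a DISCRETE GROUP of intertwiners to the Heisenberg theta model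

#8/#9 adjoined ONE element (the Weyl element `σ`, acting by `𝓕`) to the Heisenberg group.  This file does the
construction once and for all for an arbitrary discrete group `D`:

* INPUT: a homomorphism `φ : D →* MulAut (Heis V)` (how `D` acts on the Heisenberg group) and a homomorphism
  `π : D →* (𝓢(V, ℂ) →L[ℂ] 𝓢(V, ℂ))ˣ` (how `D` acts on Schwartz space) which INTERTWINE the Schrödinger–Weil
  representation `ρ_m` of #5: `ρ_m(φ_d h) = π_d ∘ ρ_m(h) ∘ π_d⁻¹` (`Intertwines`);
* OUTPUT: the representation `ρ̃(h, d) := ρ_m(h) ∘ π_d` of the semidirect product `Heis V ⋊[φ] D`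
  (`repSD`, via `SemidirectProduct.lift`), jointly continuous; Weil's theta function
  `Θ̃_Φ(x) := Θ_{ρ̃(x)Φ}(1)` on it with the `theta_act` law; the arithmetic subgroup
  `arithSD := ⟨arith(L, m), D⟩`; and — as soon as every `π_d` FIXES THE THETA DISTRIBUTION of `L`
  (`FixesTheta : Σ_{v ∈ L} (π_d Ψ)(v) = Σ_{v ∈ L} Ψ(v)`) — left `arithSD`-invariance of `Θ̃` and prl1-g4's record
  `WeilThetaModel (Heis V ⋊[φ] D) arithSD U(1) Γ` with every field a theorem (`heisenbergAdjoinModel`);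
* LATTICE JUNCTION: if moreover every `φ_d` preserves `arith` (`PreservesArith`) then `arithSD = arith ⋊ D` is
  DISCRETE and `(Heis V ⋊ D) ⧸ arithSD` is COMPACT (a continuous image of the Heisenberg nilmanifold of #7), so
  `(Heis V ⋊[φ] D, arithSD)` is a `CocompactLatticeModel` (`heisenbergAdjoinLatticeModel`, `D` countable).

The topology on `Heis V ⋊[φ] D` is the product topology of `Heis V` and the discrete `D` (instances at priority
`low`, so that the specific instances of #8 for `HeisW = Heis V ⋊ ℤ` keep precedence there); it is a topological
group as soon as every `φ_d` is continuous.  #11b (`WeilThetaModelHeisenbergPs`) instantiates this with the free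
group on the two generators `σ ↦ 𝓕` (#6/#8) and `u ↦ T_m` (the chirp of #10).

Everything is a theorem of the kernel; no cited facts.
-/

set_option autoImplicit false

noncomputable section

open Topology MeasureTheory
open scoped RealInnerProductSpace FourierTransform SchwartzMap

namespace HodgeCM
namespace SchwartzWeil

/-! ## 1. The semidirect product `Heis V ⋊[φ] D`: centre, splitting, topology -/

namespace HeisSD

variable {V : Type*} [NormedAddCommGroup V] [InnerProductSpace ℝ V] {D : Type*} [Group D]
  {φ : D →* MulAut (Heis V)}

/-- The pair map to `Heis V × D`. -/
def toProd (x : Heis V ⋊[φ] D) : Heis V × D := (x.left, x.right)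

/-- (Ported verbatim from the HodgeCMPerL package; no docstring in the source.) -/
theorem toProd_injective : Function.Injective (toProd : Heis V ⋊[φ] D → Heis V × D) := by
  intro x y h
  simp only [toProd, Prod.mk.injEq] at h
  exact SemidirectProduct.ext h.1 h.2

/-- The centre `z ↦ inl (0, 0, z)`. -/
def center : Circle →* Heis V ⋊[φ] D := SemidirectProduct.inl.comp Heis.center

/-- (Ported verbatim from the HodgeCMPerL package; no docstring in the source.) -/
theorem center_apply (z : Circle) : (center z : Heis V ⋊[φ] D) = SemidirectProduct.inl (Heis.center z) := rfl

/-- `inl (center z)` is central as soon as every `φ_d` fixes the centre pointwise. -/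
theorem center_mul_comm (hφc : ∀ (d : D) (z : Circle), φ d (Heis.center z) = Heis.center z) (z : Circle)
    (x : Heis V ⋊[φ] D) : center z * x = x * center z := by
  rw [center_apply, ← SemidirectProduct.inl_left_mul_inr_right x, ← mul_assoc, ← map_mul, Heis.center_mul_comm,
    map_mul, mul_assoc, mul_assoc]
  congr 1
  refine SemidirectProduct.ext ?_ ?_
  · simp only [SemidirectProduct.mul_left, SemidirectProduct.left_inr, SemidirectProduct.left_inl,
      SemidirectProduct.right_inr, SemidirectProduct.right_inl, one_mul, mul_one, map_one, hφc]
  · simp only [SemidirectProduct.mul_right, SemidirectProduct.right_inr, SemidirectProduct.right_inl, mul_one,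
      one_mul]

/-- The splitting `(x, z) ↦ x · c(z)` of `(Heis V ⋊ D) × U(1)` into `Heis V ⋊ D` (a homomorphism: `c(z)` is central). -/
def splitting (hφc : ∀ (d : D) (z : Circle), φ d (Heis.center z) = Heis.center z) :
    (Heis V ⋊[φ] D) × Circle →* Heis V ⋊[φ] D :=
  MonoidHom.mk' (fun p => p.1 * center p.2) (by
    intro p q
    simp only [Prod.fst_mul, Prod.snd_mul, map_mul]
    rw [mul_assoc, mul_assoc, ← mul_assoc (center p.2), center_mul_comm hφc p.2 q.1, mul_assoc])

/-- (Ported verbatim from the HodgeCMPerL package; no docstring in the source.) -/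
@[simp] theorem splitting_apply (hφc : ∀ (d : D) (z : Circle), φ d (Heis.center z) = Heis.center z)
    (p : (Heis V ⋊[φ] D) × Circle) : splitting hφc p = p.1 * center p.2 := rfl

variable [TopologicalSpace D]

/-- The product topology (of `Heis V` and `D`) on `Heis V ⋊[φ] D`. -/
instance (priority := low) instTopologicalSpace : TopologicalSpace (Heis V ⋊[φ] D) :=
  TopologicalSpace.induced toProd inferInstance

/-- (Ported verbatim from the HodgeCMPerL package; no docstring in the source.) -/
theorem continuous_toProd : Continuous (toProd : Heis V ⋊[φ] D → Heis V × D) := continuous_induced_dom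

/-- (Ported verbatim from the HodgeCMPerL package; no docstring in the source.) -/
theorem continuous_left : Continuous fun x : Heis V ⋊[φ] D => x.left := continuous_fst.comp continuous_toProd

/-- (Ported verbatim from the HodgeCMPerL package; no docstring in the source.) -/
theorem continuous_right : Continuous fun x : Heis V ⋊[φ] D => x.right := continuous_snd.comp continuous_toProd

/-- (Ported verbatim from the HodgeCMPerL package; no docstring in the source.) -/
theorem continuous_mk {X : Type*} [TopologicalSpace X] {f : X → Heis V} {g : X → D} (hf : Continuous f)
    (hg : Continuous g) : Continuous fun x => (⟨f x, g x⟩ : Heis V ⋊[φ] D) :=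
  continuous_induced_rng.2 (hf.prodMk hg)

/-- (Ported verbatim from the HodgeCMPerL package; no docstring in the source.) -/
theorem isEmbedding_toProd : IsEmbedding (toProd : Heis V ⋊[φ] D → Heis V × D) := ⟨⟨rfl⟩, toProd_injective⟩

/-- `Heis V ⋊[φ] D ≃ₜ Heis V × D`. -/
def homeomorphProd : (Heis V ⋊[φ] D) ≃ₜ Heis V × D where
  toFun := toProd
  invFun p := ⟨p.1, p.2⟩
  left_inv _ := rfl
  right_inv _ := rfl
  continuous_toFun := continuous_toProd
  continuous_invFun := continuous_mk continuous_fst continuous_snd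

/-- (Ported verbatim from the HodgeCMPerL package; no docstring in the source.) -/
@[simp] theorem homeomorphProd_apply (x : Heis V ⋊[φ] D) : homeomorphProd x = (x.left, x.right) := rfl

/-- (Ported verbatim from the HodgeCMPerL package; no docstring in the source.) -/
theorem isClosedEmbedding_toProd : IsClosedEmbedding (toProd : Heis V ⋊[φ] D → Heis V × D) :=
  (homeomorphProd (φ := φ)).isClosedEmbedding

/-- (Ported verbatim from the HodgeCMPerL package; no docstring in the source.) -/
instance (priority := low) instT2Space [T2Space D] : T2Space (Heis V ⋊[φ] D) :=
  (isClosedEmbedding_toProd (φ := φ)).isEmbedding.t2Space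

/-- (Ported verbatim from the HodgeCMPerL package; no docstring in the source.) -/
instance (priority := low) instLocallyCompactSpace [LocallyCompactSpace V] [LocallyCompactSpace D] :
    LocallyCompactSpace (Heis V ⋊[φ] D) :=
  (isClosedEmbedding_toProd (φ := φ)).locallyCompactSpace

/-- (Ported verbatim from the HodgeCMPerL package; no docstring in the source.) -/
instance (priority := low) instSecondCountableTopology [SecondCountableTopology V] [SecondCountableTopology D] :
    SecondCountableTopology (Heis V ⋊[φ] D) :=
  (isClosedEmbedding_toProd (φ := φ)).isInducing.secondCountableTopology

/-- (Ported verbatim from the HodgeCMPerL package; no docstring in the source.) -/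
theorem continuous_inl : Continuous fun h : Heis V => (SemidirectProduct.inl h : Heis V ⋊[φ] D) :=
  continuous_mk continuous_id continuous_const

/-- (Ported verbatim from the HodgeCMPerL package; no docstring in the source.) -/
theorem continuous_center : Continuous (center : Circle → Heis V ⋊[φ] D) :=
  continuous_mk (Heis.continuous_mk continuous_const continuous_const continuous_id) continuous_const

/-- (Ported verbatim from the HodgeCMPerL package; no docstring in the source.) -/
theorem continuous_splitting [IsTopologicalGroup (Heis V ⋊[φ] D)]
    (hφc : ∀ (d : D) (z : Circle), φ d (Heis.center z) = Heis.center z) :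
    Continuous (splitting hφc : (Heis V ⋊[φ] D) × Circle → Heis V ⋊[φ] D) :=
  continuous_fst.mul (continuous_center.comp continuous_snd)

variable [DiscreteTopology D]

/-- (Ported verbatim from the HodgeCMPerL package; no docstring in the source.) -/
theorem continuous_inr : Continuous fun d : D => (SemidirectProduct.inr d : Heis V ⋊[φ] D) :=
  continuous_of_discreteTopology

/-- Joint continuity of the action map `(d, h) ↦ φ_d h` (`D` is discrete). -/
theorem continuous_action (hφ : ∀ d : D, Continuous (φ d : Heis V → Heis V)) :
    Continuous fun p : D × Heis V => φ p.1 p.2 :=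
  continuous_prod_of_discrete_left.mpr hφ

/-- `Heis V ⋊[φ] D` is a topological group as soon as every `φ_d` is continuous. -/
theorem isTopologicalGroup (hφ : ∀ d : D, Continuous (φ d : Heis V → Heis V)) :
    IsTopologicalGroup (Heis V ⋊[φ] D) where
  continuous_mul := by
    refine continuous_mk ?_ ?_
    · exact (continuous_left.comp continuous_fst).mul
        ((continuous_action hφ).comp
          ((continuous_right.comp continuous_fst).prodMk (continuous_left.comp continuous_snd)))
    · exact (continuous_of_discreteTopology (f := fun p : D × D => p.1 * p.2)).comp
        ((continuous_right.comp continuous_fst).prodMk (continuous_right.comp continuous_snd))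
  continuous_inv := by
    refine continuous_mk ?_ ?_
    · exact (continuous_action hφ).comp
        (((continuous_of_discreteTopology (f := fun d : D => d⁻¹)).comp continuous_right).prodMk
          continuous_left.inv)
    · exact (continuous_of_discreteTopology (f := fun d : D => d⁻¹)).comp continuous_right

omit [DiscreteTopology D] in
/-- A discrete space is locally compact. -/
theorem locallyCompactSpace_of_discrete (E : Type*) [TopologicalSpace E] [DiscreteTopology E] :
    LocallyCompactSpace E :=
  ⟨fun x _ hn => ⟨{x}, mem_nhds_discrete.mpr (Set.mem_singleton x),
    Set.singleton_subset_iff.mpr (mem_of_mem_nhds hn), isCompact_singleton⟩⟩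

end HeisSD

/-! ## 2. The representation `ρ̃(h, d) = ρ_m(h) ∘ π_d` of `Heis V ⋊[φ] D` -/

section Rep

variable (V : Type) [NormedAddCommGroup V] [InnerProductSpace ℝ V] [FiniteDimensional ℝ V] [MeasurableSpace V]
  [BorelSpace V] (m : ℤ) {D : Type} [Group D] (φ : D →* MulAut (Heis V))
  (π : D →* (𝓢(V, ℂ) →L[ℂ] 𝓢(V, ℂ))ˣ)

/-- **The intertwining condition**: `ρ_m(φ_d h) = π_d ∘ ρ_m(h) ∘ π_d⁻¹` for all `d ∈ D`, `h ∈ Heis V`. -/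
def Intertwines : Prop := ∀ (d : D) (h : Heis V), repUnits V m (φ d h) = π d * repUnits V m h * (π d)⁻¹

variable {φ π}

/-- (Ported verbatim from the HodgeCMPerL package; no docstring in the source.) -/
theorem Intertwines.comp_eq (hc : Intertwines V m φ π) (d : D) :
    (repUnits V m).comp (φ d).toMonoidHom = (MulAut.conj (π d)).toMonoidHom.comp (repUnits V m) :=
  MonoidHom.ext fun h => by
    simp only [MonoidHom.comp_apply, MulEquiv.coe_toMonoidHom, MulAut.conj_apply]
    exact hc d h

/-- **The representation `ρ̃` of `Heis V ⋊[φ] D` on `𝓢(V, ℂ)`**: `ρ̃(h, d) = ρ_m(h) ∘ π_d`. -/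
def repSD (hc : Intertwines V m φ π) : Heis V ⋊[φ] D →* (𝓢(V, ℂ) →L[ℂ] 𝓢(V, ℂ))ˣ :=
  SemidirectProduct.lift (repUnits V m) π hc.comp_eq

/-- (Ported verbatim from the HodgeCMPerL package; no docstring in the source.) -/
theorem repSD_apply (hc : Intertwines V m φ π) (x : Heis V ⋊[φ] D) :
    repSD V m hc x = repUnits V m x.left * π x.right := rfl

/-- (Ported verbatim from the HodgeCMPerL package; no docstring in the source.) -/
theorem repSD_val_apply (hc : Intertwines V m φ π) (x : Heis V ⋊[φ] D) (Φ : 𝓢(V, ℂ)) :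
    (repSD V m hc x : 𝓢(V, ℂ) →L[ℂ] 𝓢(V, ℂ)) Φ =
      repCLM V m x.left ((π x.right : 𝓢(V, ℂ) →L[ℂ] 𝓢(V, ℂ)) Φ) := by
  rw [repSD_apply, Units.val_mul, mul_apply_eq_comp, val_repUnits]

/-- (Ported verbatim from the HodgeCMPerL package; no docstring in the source.) -/
@[simp] theorem repSD_inl_apply (hc : Intertwines V m φ π) (h : Heis V) (Φ : 𝓢(V, ℂ)) :
    (repSD V m hc (SemidirectProduct.inl h) : 𝓢(V, ℂ) →L[ℂ] 𝓢(V, ℂ)) Φ = repCLM V m h Φ := by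
  rw [repSD, SemidirectProduct.lift_inl, val_repUnits]

/-- **The adjoined elements act by `π`.** -/
@[simp] theorem repSD_inr (hc : Intertwines V m φ π) (d : D) : repSD V m hc (SemidirectProduct.inr d) = π d := by
  rw [repSD, SemidirectProduct.lift_inr]

/-- (Ported verbatim from the HodgeCMPerL package; no docstring in the source.) -/
theorem repSD_one_apply (hc : Intertwines V m φ π) (Φ : 𝓢(V, ℂ)) :
    (repSD V m hc 1 : 𝓢(V, ℂ) →L[ℂ] 𝓢(V, ℂ)) Φ = Φ := by
  rw [map_one, Units.val_one, one_apply_eq_self]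

/-- (Ported verbatim from the HodgeCMPerL package; no docstring in the source.) -/
theorem repSD_mul_apply (hc : Intertwines V m φ π) (x y : Heis V ⋊[φ] D) (Φ : 𝓢(V, ℂ)) :
    (repSD V m hc (x * y) : 𝓢(V, ℂ) →L[ℂ] 𝓢(V, ℂ)) Φ =
      (repSD V m hc x : 𝓢(V, ℂ) →L[ℂ] 𝓢(V, ℂ)) ((repSD V m hc y : 𝓢(V, ℂ) →L[ℂ] 𝓢(V, ℂ)) Φ) := by
  rw [map_mul, Units.val_mul, mul_apply_eq_comp]

variable [TopologicalSpace D] [DiscreteTopology D]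

/-- **Joint continuity of `(x, Φ) ↦ ρ̃(x) Φ`** (`D` is discrete; `ρ_m` is jointly continuous, #5). -/
theorem continuous_repSD_uncurry (hc : Intertwines V m φ π) :
    Continuous (Function.uncurry fun (x : Heis V ⋊[φ] D) (Φ : 𝓢(V, ℂ)) =>
      (repSD V m hc x : 𝓢(V, ℂ) →L[ℂ] 𝓢(V, ℂ)) Φ) := by
  have hF : Continuous fun p : D × (Heis V × 𝓢(V, ℂ)) =>
      repCLM V m p.2.1 ((π p.1 : 𝓢(V, ℂ) →L[ℂ] 𝓢(V, ℂ)) p.2.2) := by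
    refine continuous_prod_of_discrete_left.mpr fun d => ?_
    have h := (continuous_repCLM_uncurry V m).comp
      ((continuous_fst (X := Heis V) (Y := 𝓢(V, ℂ))).prodMk
        ((π d : 𝓢(V, ℂ) →L[ℂ] 𝓢(V, ℂ)).continuous.comp (continuous_snd (X := Heis V) (Y := 𝓢(V, ℂ)))))
    dsimp only [Function.comp_def, Function.uncurry_def] at h
    exact h
  have h := hF.comp (((HeisSD.continuous_right (φ := φ)).comp continuous_fst).prodMk
    (((HeisSD.continuous_left (φ := φ)).comp continuous_fst).prodMk
      (continuous_snd (X := Heis V ⋊[φ] D) (Y := 𝓢(V, ℂ)))))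
  dsimp only [Function.comp_def] at h
  simp only [Function.uncurry_def, repSD_val_apply]
  exact h

end Rep

/-! ## 3. The arithmetic subgroup `arithSD = ⟨arith(L, m), D⟩` -/

section Arith

variable (V : Type) [NormedAddCommGroup V] [InnerProductSpace ℝ V] (L : Submodule ℤ V) (m : ℤ) {D : Type} [Group D]
  (φ : D →* MulAut (Heis V))

/-- **The arithmetic subgroup of `Heis V ⋊[φ] D`**: generated by `arith(L, m)` and (all of) `D`. -/
def arithSD : Subgroup (Heis V ⋊[φ] D) :=
  (arith V L m).map (SemidirectProduct.inl : Heis V →* Heis V ⋊[φ] D) ⊔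
    (⊤ : Subgroup D).map (SemidirectProduct.inr : D →* Heis V ⋊[φ] D)

/-- (Ported verbatim from the HodgeCMPerL package; no docstring in the source.) -/
theorem inl_mem_arithSD {γ : Heis V} (hγ : γ ∈ arith V L m) :
    (SemidirectProduct.inl γ : Heis V ⋊[φ] D) ∈ arithSD V L m φ :=
  Subgroup.mem_sup_left (Subgroup.mem_map_of_mem _ hγ)

/-- (Ported verbatim from the HodgeCMPerL package; no docstring in the source.) -/
theorem inr_mem_arithSD (d : D) : (SemidirectProduct.inr d : Heis V ⋊[φ] D) ∈ arithSD V L m φ :=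
  Subgroup.mem_sup_right (Subgroup.mem_map_of_mem _ (Subgroup.mem_top d))

/-- `x ∈ arithSD` as soon as `x.left ∈ arith`. -/
theorem mem_arithSD_of_left_mem {x : Heis V ⋊[φ] D} (hx : x.left ∈ arith V L m) : x ∈ arithSD V L m φ := by
  rw [← SemidirectProduct.inl_left_mul_inr_right x]
  exact (arithSD V L m φ).mul_mem (inl_mem_arithSD V L m φ hx) (inr_mem_arithSD V L m φ x.right)

/-- (Ported verbatim from the HodgeCMPerL package; no docstring in the source.) -/
theorem center_mem_arithSD {z : Circle} (hz : z ^ m = 1) : (HeisSD.center z : Heis V ⋊[φ] D) ∈ arithSD V L m φ :=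
  inl_mem_arithSD V L m φ (center_mem_arith V L m hz)

/-- **Arithmeticity of the action**: every `φ_d` maps `arith(L, m)` into itself. -/
def PreservesArith : Prop := ∀ (d : D) ⦃h : Heis V⦄, h ∈ arith V L m → φ d h ∈ arith V L m

variable {φ}

/-- The subgroup `{x | x.left ∈ arith}` (a subgroup because `D` preserves `arith`). -/
def leftArithSD (hφa : PreservesArith V L m φ) : Subgroup (Heis V ⋊[φ] D) where
  carrier := {x | x.left ∈ arith V L m}
  one_mem' := by
    show (1 : Heis V ⋊[φ] D).left ∈ arith V L m
    rw [SemidirectProduct.one_left]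
    exact (arith V L m).one_mem
  mul_mem' {x y} hx hy := by
    show (x * y).left ∈ arith V L m
    rw [SemidirectProduct.mul_left]
    exact (arith V L m).mul_mem hx (hφa _ hy)
  inv_mem' {x} hx := by
    show x⁻¹.left ∈ arith V L m
    rw [SemidirectProduct.inv_left]
    exact hφa _ ((arith V L m).inv_mem hx)

/-- (Ported verbatim from the HodgeCMPerL package; no docstring in the source.) -/
theorem mem_leftArithSD (hφa : PreservesArith V L m φ) {x : Heis V ⋊[φ] D} :
    x ∈ leftArithSD V L m hφa ↔ x.left ∈ arith V L m :=
  Iff.rfl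

/-- **`arithSD = {x | x.left ∈ arith} = arith ⋊ D`** when `D` preserves `arith`. -/
theorem arithSD_eq_leftArithSD (hφa : PreservesArith V L m φ) : arithSD V L m φ = leftArithSD V L m hφa := by
  refine le_antisymm (sup_le (Subgroup.map_le_iff_le_comap.mpr fun γ hγ => ?_)
    (Subgroup.map_le_iff_le_comap.mpr fun d _ => ?_)) fun x hx => mem_arithSD_of_left_mem V L m φ hx
  · show (SemidirectProduct.inl γ : Heis V ⋊[φ] D).left ∈ arith V L m
    rwa [SemidirectProduct.left_inl]
  · show (SemidirectProduct.inr d : Heis V ⋊[φ] D).left ∈ arith V L m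
    rw [SemidirectProduct.left_inr]
    exact (arith V L m).one_mem

/-- (Ported verbatim from the HodgeCMPerL package; no docstring in the source.) -/
theorem left_mem_arith_of_mem_arithSD (hφa : PreservesArith V L m φ) {x : Heis V ⋊[φ] D}
    (hx : x ∈ arithSD V L m φ) : x.left ∈ arith V L m := by
  rwa [arithSD_eq_leftArithSD V L m hφa] at hx

variable (φ)

/-- The comparison map `Heis V ⧸ arith → (Heis V ⋊ D) ⧸ arithSD`, `h·arith ↦ (h, 1)·arithSD`. -/
def quotientMapSD : Heis V ⧸ arith V L m → (Heis V ⋊[φ] D) ⧸ arithSD V L m φ :=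
  Quotient.lift
    (fun h : Heis V => (QuotientGroup.mk (SemidirectProduct.inl h) : (Heis V ⋊[φ] D) ⧸ arithSD V L m φ))
    fun a b hab => QuotientGroup.eq.mpr (by
      rw [← map_inv, ← map_mul]
      exact inl_mem_arithSD V L m φ (QuotientGroup.leftRel_apply.mp hab))

/-- (Ported verbatim from the HodgeCMPerL package; no docstring in the source.) -/
theorem quotientMapSD_mk (h : Heis V) :
    quotientMapSD V L m φ (QuotientGroup.mk h) = QuotientGroup.mk (SemidirectProduct.inl h) := rfl

/-- (Ported verbatim from the HodgeCMPerL package; no docstring in the source.) -/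
theorem surjective_quotientMapSD : Function.Surjective (quotientMapSD V L m φ) := by
  intro q
  induction q using QuotientGroup.induction_on with
  | H x =>
    refine ⟨QuotientGroup.mk x.left, ?_⟩
    rw [quotientMapSD_mk, QuotientGroup.eq]
    refine mem_arithSD_of_left_mem V L m φ ?_
    rw [← map_inv, SemidirectProduct.mul_left, SemidirectProduct.left_inl, SemidirectProduct.right_inl, map_one,
      MulAut.one_apply, inv_mul_cancel]
    exact (arith V L m).one_mem

variable [TopologicalSpace D]

/-- (Ported verbatim from the HodgeCMPerL package; no docstring in the source.) -/
theorem continuous_quotientMapSD : Continuous (quotientMapSD V L m φ) :=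
  (QuotientGroup.continuous_mk.comp HeisSD.continuous_inl).quotient_lift _

variable [FiniteDimensional ℝ V] [DiscreteTopology L] [IsZLattice ℝ L] [NeZero m]

/-- **`(Heis V ⋊ D) ⧸ arithSD` is COMPACT** (a continuous image of the Heisenberg nilmanifold of #7). -/
instance (priority := low) instCompactSpaceQuotientArithSD : CompactSpace ((Heis V ⋊[φ] D) ⧸ arithSD V L m φ) :=
  ⟨by
    rw [← Set.range_eq_univ.mpr (surjective_quotientMapSD V L m φ)]
    exact isCompact_range (continuous_quotientMapSD V L m φ)⟩

variable {φ} [DiscreteTopology D]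


-- port_pkg: scope closed for this part
end Arith
end SchwartzWeil
end HodgeCM
end
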